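import Summits.BirchSwinnertonDyer.Rank1Residual.Additive.X4RankZeroVisibleLowerBoundPlacesSix
import HarnessLib

/-!
# X4 ∧ `r = 0`: the visibility record sockets in TRANSPORT currency — per place, "the local Kummer
# conditions of `E′` transport into those of `E` along `θ`" (`ι_v(θ) = 1`), whatever the kind
# (cell `b2b-bsdres`, team n1011; ROW T-VIS3-TATE-REC FILE 3, seat p14 GEN 5; TOOL file)

HONEST FRAMING (cell `b2b-bsdres`, run/shared/lean/b2b/bsd-rank1-residual/, verbatim in every
file): the goal of the cell is to DELETE the COMBINATION-SHAPED residual classes of the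
Birch–Swinnerton-Dyer formula for ALL analytic-rank `≤ 1` elliptic curves over `ℚ` — "full BSD
formula for every rank `≤ 1` curve in class `C`" assembled STRICTLY from published theorems — so
that the rank-`≤ 1` remainder becomes exactly the CONSTRUCTION-SHAPED classes, which are TYPED
(missing-input `Prop`s), NOT attempted. This is not "finishing BSD". Team n1011 (N11 = X4 ∧ `p = 3`):
research route on the CONSTRUCTION-SHAPED class X4; TOOL theorems only (no definition, no new named
fact, no `sorry`); CONDITIONAL on the named facts displayed as hypotheses (the seven UPPER-half facts of
the (M)-END resp. Kato's for potentially good rows — NOT on A40/A41: Tate uniformisation enters only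
through whichever per-place kind lemma a record chooses); closes NO class and NO row by itself; a record
over these sockets closes NOTHING beyond its displayed binders; nothing booked; no mark / label / count moved.

## Why

FILE 1 (`X4RankZeroVisibleLowerBoundPlacesSix.lean`, p313564) gave the record socket over the SIX-KIND
disjunction of n1011-p09's `…_of_places₆`.  But the kind lemmas of the cell come in TWO currencies:
disjunct data (kinds (i), (iii′), (iv′), (vi) — `…_of_places₆`) and the COMPARISON INDEX
`ι_v(θ) = [θ_* 𝓢_v(E′) : θ_* 𝓢_v(E′) ∩ 𝓢_v(E)] = 1` (n1011-p17's D9 `relIndex_eq_one_of_kindIII_checks_of_intModel`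
/ `…_of_kindII_checks_of_intModel` at multiplicative places, the Literature's
`relIndex_map_selmerLocalKer_eq_one_of_card_torsion_eq_one`, p09's
`TwistedKummer.relIndex_map_selmerLocalKer_eq_one_of_one_lt_valuation_j`, T-2LL's kind (vii) …).  The
Literature's hybrid count `WeierstrassCurve.exists_sha_ne_zero_of_congr_of_le_off` takes exactly the
transport statement per place; composed with FILE 1 §1's kind-agnostic ENDs and §2's place-list
plumbing it gives ONE socket per row type in which a record discharges EACH place by WHICHEVER kind
lemma applies (stated as `ι_v(θ) = 1`), with no paid place (`T = ∅`, budget `1 < 3^{rank E′}`):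
* `X4RankZero.bsdp_three_potMult_of_congr_of_transport_of_primeList` — (M) rows (`ord₃ j < 0`);
* `X4RankZero.bsdp_three_of_congr_of_transport_of_kato_of_primeList` — potentially good rows (odd `p = 3`
  instance of FILE 1 §1's Kato END; tower, `3 ∤ ∏ c_ℓ`, parametrisation datum displayed as there).

References: [CremonaMazur2000] §3; [AgasheStein2002] Thm. 3.1, §3.5; [Kato2004Asterisque] Thm. 14.5 (3);
[Delbourgo1998] Prop. 4; [SilvermanAEC2009] VII.5.1 (a), X.4.2 (a), X.4.14; [MilneADT2006] I.3.3, I.3.8.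
-/

set_option autoImplicit false

noncomputable section

open scoped Classical NumberField
open IsDedekindDomain NumberField WeierstrassCurve Rat.HeightOneSpectrum
  Literature.NumberTheory.EllipticCurves Literature.NumberTheory.EllipticCurves.ModularForms
  Literature.NumberTheory.EllipticCurves.Rank1Residual
  Literature.NumberTheory.EllipticCurves.Rank1Residual.Typed
  Literature.NumberTheory.GaloisRepresentations
  Summit.BirchSwinnertonDyer.Rank1Residual.GaloisImage

namespace Summit.BirchSwinnertonDyer.Rank1Residual.Additive

/-- **The visible element from a transport certificate in prime-list form** (`K = ℚ`, `p = 3`, NO paid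
place): if `E(ℚ)` is finite of order prime to `3`, `rank E′ ≥ 1`, and at every place `v` over a prime
list `L ∋ 3` supporting both discriminants the comparison index `ι_v(θ) = 1`, then `Ш(E)[3] ≠ 0`
(the Literature's `exists_sha_ne_zero_of_congr_of_rank_of_le` with `S` = places over `L`, the transport supplied at every place of `S`).
[cite: CremonaMazur2000, §3 and Table 1] [cite: AgasheStein2002, Thm. 3.1 and §3.5] -/
theorem exists_sha_ne_zero_three_of_congr_of_transport_of_primeList
    (W W' : WeierstrassCurve ℚ) [W.IsElliptic] [W'.IsElliptic]
    (θ : geomTorsion W' ((3 : ℕ) : ℤ) ≃+ geomTorsion W ((3 : ℕ) : ℤ))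
    (hθ : ∀ (σ : Field.absoluteGaloisGroup ℚ) (P : geomTorsion W' ((3 : ℕ) : ℤ)),
      θ (σ • P) = σ • θ P)
    (hfin : Finite W.toAffine.Point) (hcop : (Nat.card W.toAffine.Point).Coprime 3)
    (hrank : 1 ≤ W'.mordellWeilRank)
    {E₀ F₀ : WeierstrassCurve ℤ} (hE : E₀.map (Int.castRingHom ℚ) = W)
    (hF : F₀.map (Int.castRingHom ℚ) = W') (L : List ℕ) (h3L : 3 ∈ L)
    (hΔE : ∀ q : ℕ, q.Prime → (q : ℤ) ∣ E₀.Δ → q ∈ L)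
    (hΔF : ∀ q : ℕ, q.Prime → (q : ℤ) ∣ F₀.Δ → q ∈ L)
    (htrans : ∀ w : HeightOneSpectrum (𝓞 ℚ), (primesEquiv w : ℕ) ∈ L →
      (selmerLocalKer W (w.adicCompletion ℚ) ((3 : ℕ) : ℤ)).relIndex
        ((selmerLocalKer W' (w.adicCompletion ℚ) ((3 : ℕ) : ℤ)).map (h1Equiv θ hθ).toAddMonoidHom) = 1) :
    ∃ c : W.sha, c ≠ 0 ∧ (3 : ℕ) • c = 0 := by
  haveI : Fact (Nat.Prime 3) := ⟨Nat.prime_three⟩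
  obtain ⟨S, hS⟩ := exists_placeFinset_of_primeList L
  -- the Literature's refined count with `T` = the kind-(i) places chosen internally; we supply the
  -- transport at EVERY place of `S`, so its precondition is not needed
  exact WeierstrassCurve.exists_sha_ne_zero_of_congr_of_rank_of_le W W' (by norm_num) θ hθ S
    (good_and_not_mem_of_not_mem_placeFinset hE hF L Nat.prime_three h3L hΔE hΔF hS) hfin hcop hrank
    (fun w hw _ c hc ↦
      (relIndex_map_selmerLocalKer_eq_one_iff W W' θ hθ).mp (htrans w ((hS w).mp hw)) c hc)

/-- **Record socket in TRANSPORT currency, (M) rows.** `BSD(E,3)` for an X4 ∧ `r_an = 0` row `E = W`,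
potentially multiplicative at `3` (`ord₃ j < 0`; an add-pm-at-`3` row IS an (M) row), `ρ̄_{E,3}` onto,
`ord₃ #Ш_an ≤ 2`, from a `3`-CONGRUENT partner `E′ = W′` of rank `≥ 1` whose local Kummer conditions
TRANSPORT into those of `E` along `θ` — `ι_v(θ) = 1` — at EVERY place over a prime list `L ∋ 3`
supporting both discriminants; the record proves each `ι_v(θ) = 1` by the kind lemma of its choice
(kind (i) `relIndex_map_selmerLocalKer_eq_one_of_card_torsion_eq_one`; (iii′) p09's
`TwistedKummer.relIndex_map_selmerLocalKer_eq_one_of_one_lt_valuation_j`; (ii)/(iii) at multiplicative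
places p17's `relIndex_eq_one_of_kind{II,III}_checks_of_intModel`; …), so the socket itself displays NO
Tate-uniformisation fact.  `T = ∅` (no paid place; budget `1 < 3^{rank E′}`); `E(ℚ)` finite and
`3 ∤ #E(ℚ)` discharged inside (`hGZK`, `hr`, surj(3)); FILE 1 §1's END concludes.  A record over this
socket closes NOTHING beyond its displayed binders; closes no class.
[cite: CremonaMazur2000, §3 and Table 1] [cite: AgasheStein2002, Thm. 3.1 and §3.5]
[cite: Delbourgo1998, Prop. 4 (p. 144)] [cite: SilvermanAEC2009, Thm. X.4.2 (a) and X.4.14] -/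
theorem X4RankZero.bsdp_three_potMult_of_congr_of_transport_of_primeList
    (hKatoS : Kato2004.rankZero_padicValNat_sha_le_sub_localTamagawa_of_additive_potGood_of_imageContainsSL2)
    (hDel : Delbourgo1998.prop4_rankZero_pow_dvd_constantCoeff)
    (hGZK : rank_eq_analyticRank_of_analyticRank_le_one) (hmod : hasEntireLFunction_rat)
    (hmodD : nonempty_modularParametrizationData)
    (hKatoχ : Wuthrich2014.kato_halfEigenCharIdeal_dvd_cyclotomicPrime_of_surjective)
    (hCT : exists_casselsTate_pairing (K := ℚ))
    (W : WeierstrassCurve ℚ) [W.IsElliptic] [W.IsGloballyMinimal] (hr : W.analyticRank = 0)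
    (hX : haveI : Fact (Nat.Prime 3) := ⟨Nat.prime_three⟩; ClassX4 W 3)
    (hsurj : W.HasSurjectiveModNGaloisRep 3) (hj : padicValRat 3 W.j < 0)
    {q : ℚ} (hq : shaAn W = (q : ℂ)) (hv : padicValRat 3 q ≤ 2)
    (W' : WeierstrassCurve ℚ) [W'.IsElliptic]
    (θ : geomTorsion W' ((3 : ℕ) : ℤ) ≃+ geomTorsion W ((3 : ℕ) : ℤ))
    (hθ : ∀ (σ : Field.absoluteGaloisGroup ℚ) (P : geomTorsion W' ((3 : ℕ) : ℤ)),
      θ (σ • P) = σ • θ P)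
    (hrank : 1 ≤ W'.mordellWeilRank)
    {E₀ F₀ : WeierstrassCurve ℤ} (hE : E₀.map (Int.castRingHom ℚ) = W)
    (hF : F₀.map (Int.castRingHom ℚ) = W') (L : List ℕ) (h3L : 3 ∈ L)
    (hΔE : ∀ q : ℕ, q.Prime → (q : ℤ) ∣ E₀.Δ → q ∈ L)
    (hΔF : ∀ q : ℕ, q.Prime → (q : ℤ) ∣ F₀.Δ → q ∈ L)
    (htrans : ∀ w : HeightOneSpectrum (𝓞 ℚ), (primesEquiv w : ℕ) ∈ L →
      (selmerLocalKer W (w.adicCompletion ℚ) ((3 : ℕ) : ℤ)).relIndex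
        ((selmerLocalKer W' (w.adicCompletion ℚ) ((3 : ℕ) : ℤ)).map (h1Equiv θ hθ).toAddMonoidHom) = 1) :
    haveI : Fact (Nat.Prime 3) := ⟨Nat.prime_three⟩
    BSDp W 3 := by
  haveI : Fact (Nat.Prime 3) := ⟨Nat.prime_three⟩
  haveI hfinpt : Finite W.toAffine.Point := finite_point_of_analyticRank_eq_zero W hGZK hr
  have hirr : Irr W 3 := hasIrreducibleModPGaloisRep_of_hasSurjectiveModNGaloisRep W 3 hsurj
  exact X4RankZero.bsdp_three_potMult_of_exists_sha_three_torsion hKatoS hDel hGZK hmod hmodD hKatoχ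
    hCT W hr hX hsurj hj hq hv
    (exists_sha_ne_zero_three_of_congr_of_transport_of_primeList W W' θ hθ hfinpt
      (coprime_natCard_point_of_irr W 3 hirr) hrank hE hF L h3L hΔE hΔF htrans)

/-- **Record socket in TRANSPORT currency, potentially GOOD rows** (`0 ≤ ord₃ j`; the `3`-adic tower
onto, `3 ∤ ∏ c_ℓ`, a parametrisation datum with `3 ∤ c_D` — FILE 1 §1's Kato END): the same transport
certificate (`ι_v(θ) = 1` at every place over `L`, `T = ∅`, `rank E′ ≥ 1`) gives `BSD(E,3)`.
Displays NO Tate-uniformisation fact itself; closes NOTHING beyond a record's displayed binders.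
[cite: CremonaMazur2000, §3 and Table 1] [cite: Kato2004Asterisque, Thm. 14.5 (3) (p. 236)]
[cite: SilvermanAEC2009, Thm. X.4.14] -/
theorem X4RankZero.bsdp_three_of_congr_of_transport_of_kato_of_primeList
    (hKato : Kato2004.rankZero_padicValNat_sha_le_of_additive_potGood_of_imageContainsSL2)
    (hCT : exists_casselsTate_pairing (K := ℚ))
    (hGZK : rank_eq_analyticRank_of_analyticRank_le_one) (hmod : hasEntireLFunction_rat)
    (W : WeierstrassCurve ℚ) [W.IsElliptic] [W.IsGloballyMinimal] (hr : W.analyticRank = 0)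
    (hX : haveI : Fact (Nat.Prime 3) := ⟨Nat.prime_three⟩; ClassX4 W 3) (hpot : 0 ≤ padicValRat 3 W.j)
    (hsurj : ∀ n : ℕ, W.HasSurjectiveModNGaloisRep (3 ^ n : ℕ)) (htam : ¬ 3 ∣ W.tamagawaProduct)
    {N : ℕ} [NeZero N] (D : ModularParametrizationData W N) (hc : ¬ ((3 : ℕ) : ℤ) ∣ D.maninConstant)
    {q : ℚ} (hq : shaAn W = (q : ℂ)) (hv : padicValRat 3 q ≤ 2)
    (W' : WeierstrassCurve ℚ) [W'.IsElliptic]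
    (θ : geomTorsion W' ((3 : ℕ) : ℤ) ≃+ geomTorsion W ((3 : ℕ) : ℤ))
    (hθ : ∀ (σ : Field.absoluteGaloisGroup ℚ) (P : geomTorsion W' ((3 : ℕ) : ℤ)),
      θ (σ • P) = σ • θ P)
    (hrank : 1 ≤ W'.mordellWeilRank)
    {E₀ F₀ : WeierstrassCurve ℤ} (hE : E₀.map (Int.castRingHom ℚ) = W)
    (hF : F₀.map (Int.castRingHom ℚ) = W') (L : List ℕ) (h3L : 3 ∈ L)
    (hΔE : ∀ q : ℕ, q.Prime → (q : ℤ) ∣ E₀.Δ → q ∈ L)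
    (hΔF : ∀ q : ℕ, q.Prime → (q : ℤ) ∣ F₀.Δ → q ∈ L)
    (htrans : ∀ w : HeightOneSpectrum (𝓞 ℚ), (primesEquiv w : ℕ) ∈ L →
      (selmerLocalKer W (w.adicCompletion ℚ) ((3 : ℕ) : ℤ)).relIndex
        ((selmerLocalKer W' (w.adicCompletion ℚ) ((3 : ℕ) : ℤ)).map (h1Equiv θ hθ).toAddMonoidHom) = 1) :
    haveI : Fact (Nat.Prime 3) := ⟨Nat.prime_three⟩
    BSDp W 3 := by
  haveI : Fact (Nat.Prime 3) := ⟨Nat.prime_three⟩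
  haveI hfinpt : Finite W.toAffine.Point := finite_point_of_analyticRank_eq_zero W hGZK hr
  have hirr : Irr W 3 :=
    hasIrreducibleModPGaloisRep_of_hasSurjectiveModNGaloisRep W 3 (by simpa using hsurj 1)
  exact X4RankZero.bsdp_of_exists_sha_torsion_of_kato hKato hCT hGZK hmod W 3 hr hX hpot hsurj htam D hc
    hq hv
    (exists_sha_ne_zero_three_of_congr_of_transport_of_primeList W W' θ hθ hfinpt
      (coprime_natCard_point_of_irr W 3 hirr) hrank hE hF L h3L hΔE hΔF htrans)

end Summit.BirchSwinnertonDyer.Rank1Residual.Additive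

end
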